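import Summits.HodgeConjecture.CorCM.PairFlipTransportDichotomy
import Summits.HodgeConjecture.CorCM.PairFlipCompanionRealSubfield
import HarnessLib

/-!
# A generic CM abelian variety against any CM abelian variety of the same dimension over a compatible real field:
# `Hg(A₀ × A₁) = Hg(A₀) × Hg(A₁)` UNLESS `A₀` and `A₁` are isogenous

COR-CM (cell `pub-hodgecm2`, binder seat `b16` gen 51, count-neutral claim PAIRFLIP-COMPANION, file F6 — CM fields and
abelian varieties; theorems only, no definition, no named fact, no `sorry`).  NEW as stated, hence under `Summits/`.
HONEST FRAMING: unconditional theorems on pairs of CM abelian varieties; `HC_CM` is neither used nor asserted.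

SETTING (F2 `PairFlipCompanionCMFieldsHodge`): `K_{i₀}` a CM field with PAIR FLIPS COMPATIBLE WITH `K_{i₁}` (every
conjugate pair of embeddings of `K_{i₀}` is exchanged by an automorphism of `ℂ` fixing the other embeddings of `K_{i₀}`
and mapping each embedding of `K_{i₁}` to itself or its conjugate — automatic over a common totally real field,
`pairFlip_compatible_of_ringHom_real`), `[K_{i₀}:ℚ] = [K_{i₁}:ℚ]`, `I = {i₀, i₁}`, types `Φ_{i₀}`, `Φ_{i₁}`.  F2/F3 needed
`K_{i₀} ≇ K_{i₁}` (or simplicity and seat p2's same-field theorem); the TYPED transport of F5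
(`PairFlipTransport.exists_equivariant_equiv_mem_iff_of_not_additive`) removes both:

* §1 `exists_ringEquiv_forall_mem_iff_of_equivariant` — an `Aut(ℂ)`-equivariant bijection `γ : Hom(K_{i₀}, ℂ) ≃
  Hom(K_{i₁}, ℂ)` carrying `Φ_{i₀}` onto `Φ_{i₁}` comes from a field isomorphism `e : K_{i₀} ≅ K_{i₁}` with
  `Φ_{i₁} = Φ_{i₀} ∘ e⁻¹` (`u ∈ Φ_{i₁} ↔ u ∘ e ∈ Φ_{i₀}`): the types are CM-EQUIVALENT.
* §2 **`additive_or_exists_ringEquiv_of_pairFlip_compatible`** — EITHER `rank(Φ_{i₀}, Φ_{i₁}) + 2 = rank Φ_{i₀} +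
  rank Φ_{i₁} + 1` (`Hg(A₀ × A₁) = Hg(A₀) × Hg(A₁)`), OR `K_{i₀} ≅ K_{i₁}` by an isomorphism carrying `Φ_{i₀}` to `Φ_{i₁}`;
  hence **`cmFamilyRank_add_card_eq_of_pairFlip_compatible_of_isSeparatingFamily`** (a SEPARATING pair is additive) and,
  for realisations, **`additive_or_isIsogenous_of_pairFlip_compatible`**: additive OR `A₀ ~ A₁` ISOGENOUS
  (Shimura: CM-equivalent types have isogenous realisations) — no simplicity, no hypothesis on the fields beyond
  compatibility and equal degree.
* §3 consequences: **`isNondegenerateFamily_iff_of_pairFlip_compatible_of_not_isIsogenous`** (`A₀ ≁ A₁` ⟹ the family is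
  nondegenerate iff `Φ_{i₁}` is); **`hodgeConjectureFor_prod_of_pairFlip_compatible_of_not_isIsogenous`** (then the Hodge
  conjecture with `B• = D•` on every `A₀^a × A₁^b`, UNCONDITIONALLY); the common-real-field forms
  `additive_or_isIsogenous_of_pairFlip_of_ringHom_real`, `hodgeConjectureFor_prod_of_pairFlip_of_ringHom_real'`.

## References

* [Shimura1998] G. Shimura, *Abelian Varieties with Complex Multiplication and Modular Functions*, §6.1 Cor., §8.3,
  §32.10.
* [Gordon1999HodgeAVSurvey] B. B. Gordon, *A survey of the Hodge conjecture for abelian varieties*, §3 Theorem, 7.4–7.7,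
  10.10.
* [Dodson1984] B. Dodson, *The structure of Galois groups of CM-fields*, Trans. AMS 283 (1984), §1.1, §5.1.2.
* [Lang2002] S. Lang, *Algebra*, GTM 211, VI §1 Thm. 1.1 and Cor. 1.6.
-/

noncomputable section

open CategoryTheory CategoryTheory.Limits NumberField Module IntermediateField

namespace Summit.HodgeConjecture.CorCM

open Literature.NumberTheory.ComplexMultiplication
open Literature.AlgebraicGeometry.Motives (AbelianVariety CMType)
open Literature.AlgebraicGeometry.HodgeTheory
open Literature.AlgebraicGeometry.ComplexMultiplication (IsCMTypeRealisation isSimple_iff_isPrimitive)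
open Literature.AlgebraicGeometry.VanGeemen1994 (hodgeClassSpan)
open Literature.AlgebraicGeometry.Pohlmann1968
open Literature.Barriers.HodgeConjecture (divisorClassesSpan)

variable {I : Type} {K : I → Type} [∀ i, Field (K i)] [∀ i, NumberField (K i)] [∀ i, IsCMField (K i)] [Fintype I]
  [DecidableEq I] {Φ : ∀ i, CMType (K i)}

/-! ## §1 A typed equivariant bijection of embedding sets is a CM-equivalence of the types -/

section Relabel

omit [∀ i, IsCMField (K i)] [Fintype I] [DecidableEq I] in
/-- **A typed relabelling is a CM-equivalence.**  An `Aut(ℂ)`-equivariant bijection `γ : Hom(K_i, ℂ) ≃ Hom(K_j, ℂ)` with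
`x ∈ Φ_i ↔ γx ∈ Φ_j` comes from a field isomorphism `e : K_i ≅ K_j` with `γ(x) ∘ e = x`, so `u ∈ Φ_j ↔ u ∘ e ∈ Φ_i`
(equal stabilisers give equal images `x(K_i) = γx(K_j)`; `e = (γx₀)⁻¹ ∘ x₀`, and by equivariance the same `e` serves
every embedding). [cite: Lang2002, VI §1 Thm. 1.1 and Cor. 1.6] [cite: Shimura1998, §8.3] -/
theorem exists_ringEquiv_forall_mem_iff_of_equivariant {i j : I} (γ : (K i →+* ℂ) ≃ (K j →+* ℂ))
    (hγ : ∀ (g : ℂ ≃+* ℂ) (x : K i →+* ℂ), γ (g • x) = g • γ x) (hΦ : ∀ x : K i →+* ℂ, x ∈ (Φ i).1 ↔ γ x ∈ (Φ j).1) :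
    ∃ e : K i ≃+* K j, ∀ u : K j →+* ℂ, u ∈ (Φ j).1 ↔ u.comp e.toRingHom ∈ (Φ i).1 := by
  haveI := isPretransitive_ringEquiv_complex (K := K j)
  obtain ⟨x₀⟩ : Nonempty (K i →+* ℂ) := inferInstance
  have h1 : x₀.toRatAlgHom.fieldRange ≤ (γ x₀).toRatAlgHom.fieldRange :=
    fieldRange_le_of_stabilizer_le fun τ hτ => γ.injective (by rw [hγ, hτ])
  have h2 : (γ x₀).toRatAlgHom.fieldRange ≤ x₀.toRatAlgHom.fieldRange :=
    fieldRange_le_of_stabilizer_le fun τ hτ => by rw [← hγ, hτ]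
  have heq := le_antisymm h1 h2
  let e : K i ≃ₐ[ℚ] K j := (AlgEquiv.ofInjectiveField x₀.toRatAlgHom).trans
    ((IntermediateField.equivOfEq heq).trans (AlgEquiv.ofInjectiveField (γ x₀).toRatAlgHom).symm)
  -- `γ(x₀) ∘ e = x₀`
  have he : ∀ a, (γ x₀) (e a) = x₀ a := by
    intro a
    have h3 : (AlgEquiv.ofInjectiveField (γ x₀).toRatAlgHom) (e a) =
        (IntermediateField.equivOfEq heq) (AlgEquiv.ofInjectiveField x₀.toRatAlgHom a) := by
      show (AlgEquiv.ofInjectiveField (γ x₀).toRatAlgHom) ((AlgEquiv.ofInjectiveField (γ x₀).toRatAlgHom).symm _) = _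
      exact AlgEquiv.apply_symm_apply _ _
    have h4 : ((AlgEquiv.ofInjectiveField (γ x₀).toRatAlgHom) (e a) : ℂ) = (γ x₀) (e a) :=
      AlgEquiv.ofInjective_apply (γ x₀).toRatAlgHom (γ x₀).toRatAlgHom.injective (e a)
    have h5 : ((IntermediateField.equivOfEq heq) (AlgEquiv.ofInjectiveField x₀.toRatAlgHom a) : ℂ) = x₀ a := by
      rw [IntermediateField.equivOfEq_apply]
      exact AlgEquiv.ofInjective_apply x₀.toRatAlgHom x₀.toRatAlgHom.injective a
    rw [← h4, h3, h5]
  refine ⟨e.toRingEquiv, fun u => ?_⟩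
  -- `u = σ ∘ γ(x₀)` for some `σ`, and then `u ∘ e = σ ∘ x₀`
  obtain ⟨σ, rfl⟩ := MulAction.exists_smul_eq (ℂ ≃+* ℂ) (γ x₀) u
  have hu : (σ • γ x₀).comp e.toRingEquiv.toRingHom = σ • x₀ := RingHom.ext fun a => by
    rw [RingHom.comp_apply, ringEquiv_smul_apply, ringEquiv_smul_apply]
    exact congrArg σ (he a)
  rw [hu, ← hγ, hΦ]

end Relabel

/-! ## §2 Additive, or isomorphic fields with CM-equivalent types -/

section Dichotomy

variable [Nonempty I]

omit [∀ i, IsCMField (K i)] [DecidableEq I] [Nonempty I] in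
/-- `|⊔_i Hom(K_i, ℂ)| = Σ_i [K_i : ℚ]`. [folklore] -/
private theorem card_sigma_ringHom_eq_sum₅₁ :
    Fintype.card ((i : I) × (K i →+* ℂ)) = ∑ i, finrank ℚ (K i) := by
  rw [Fintype.card_sigma]
  exact Finset.sum_congr rfl fun i _ => Embeddings.card (K i) ℂ

/-- **Slot extensions inside `U(Σ)` decide nondegeneracy member by member** (number-field dress of the tree's
`typeRank_sigmaType_eq_iff_forall_of_forall_map_le`). [cite: Gordon1999HodgeAVSurvey, §3 Theorem and 7.5] -/
theorem isNondegenerateFamily_iff_forall_of_forall_map_le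
    (hall : ∀ i, (antiSpan (ℂ ≃+* ℂ) (Φ i).1).map (slotExt i) ≤ antiSpan (ℂ ≃+* ℂ) (CMAlgebra.familyType Φ)) :
    CMAlgebra.IsNondegenerateFamily Φ ↔ ∀ i, IsNondegenerate (Φ i) := by
  have key := typeRank_sigmaType_eq_iff_forall_of_forall_map_le (G := ℂ ≃+* ℂ) (Φ := fun i => (Φ i).1)
    (fun i => isCMTypeWith_conj (Φ i)) hall
  rw [CMAlgebra.isNondegenerateFamily_iff, ← card_sigma_ringHom_eq_sum₅₁ (K := K)]
  refine key.trans (forall_congr' fun i => ?_)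
  rw [isNondegenerate_iff, cmTypeRank, ← Embeddings.card (K i) ℂ]

omit [Nonempty I] in
/-- **The dichotomy.**  `K_{i₀}` with pair flips compatible with `K_{i₁}`, equal degrees, `I = {i₀, i₁}`, `i₀ ≠ i₁`:
EITHER every slot extension lies in `U(Σ)` — the pair is ADDITIVE, `Hg(A₀ × A₁) = Hg(A₀) × Hg(A₁)` — OR there is a field
isomorphism `e : K_{i₀} ≅ K_{i₁}` with `Φ_{i₁} = Φ_{i₀} ∘ e⁻¹` (CM-equivalent types).
[cite: Gordon1999HodgeAVSurvey, §3 Theorem and 7.5–7.7] [cite: Dodson1984, §5.1.2] [cite: Shimura1998, §32.10] -/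
theorem forall_map_le_or_exists_ringEquiv_of_pairFlip_compatible {i₀ i₁ : I} (hI : ∀ j, j = i₀ ∨ j = i₁)
    (h01 : i₀ ≠ i₁)
    (hflip : ∀ s : K i₀ →+* ℂ, ∃ σ : ℂ ≃+* ℂ, σ • s = (starRingAut : ℂ ≃+* ℂ) • s ∧
      (∀ t : K i₀ →+* ℂ, t ≠ s → t ≠ (starRingAut : ℂ ≃+* ℂ) • s → σ • t = t) ∧
      ∀ y : K i₁ →+* ℂ, σ • y = y ∨ σ • y = (starRingAut : ℂ ≃+* ℂ) • y)
    (hdeg : finrank ℚ (K i₀) = finrank ℚ (K i₁)) :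
    (∀ i, (antiSpan (ℂ ≃+* ℂ) (Φ i).1).map (slotExt i) ≤ antiSpan (ℂ ≃+* ℂ) (CMAlgebra.familyType Φ)) ∨
      ∃ e : K i₀ ≃+* K i₁, ∀ u : K i₁ →+* ℂ, u ∈ (Φ i₁).1 ↔ u.comp e.toRingHom ∈ (Φ i₀).1 := by
  classical
  haveI := isPretransitive_ringEquiv_complex (K := K i₀)
  have hcard : Fintype.card (K i₀ →+* ℂ) = Fintype.card (K i₁ →+* ℂ) := by
    rw [Embeddings.card, Embeddings.card, hdeg]
  by_cases hadd : ∀ i, (antiSpan (ℂ ≃+* ℂ) (Φ i).1).map (slotExt i) ≤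
      antiSpan (ℂ ≃+* ℂ) (sigmaType (E := fun i => K i →+* ℂ) fun i => (Φ i).1)
  · exact Or.inl hadd
  · obtain ⟨γ, hγ, hΦ⟩ := PairFlipTransport.exists_equivariant_equiv_mem_iff_of_not_additive
      (Φ := fun i => (Φ i).1) (fun i => isCMTypeWith_conj (Φ i)) hI h01 hflip hcard hadd
    exact Or.inr (exists_ringEquiv_forall_mem_iff_of_equivariant (Φ := Φ) γ hγ hΦ)

/-- **Rank form**: `rank(Φ_{i₀}, Φ_{i₁}) + 2 = rank Φ_{i₀} + rank Φ_{i₁} + 1` (`Hg(A₀ × A₁) = Hg(A₀) × Hg(A₁)`), or the types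
are CM-equivalent along a field isomorphism. [cite: Gordon1999HodgeAVSurvey, §3 Theorem (1) and 7.5–7.7] -/
theorem additive_or_exists_ringEquiv_of_pairFlip_compatible {i₀ i₁ : I} (hI : ∀ j, j = i₀ ∨ j = i₁) (h01 : i₀ ≠ i₁)
    (hflip : ∀ s : K i₀ →+* ℂ, ∃ σ : ℂ ≃+* ℂ, σ • s = (starRingAut : ℂ ≃+* ℂ) • s ∧
      (∀ t : K i₀ →+* ℂ, t ≠ s → t ≠ (starRingAut : ℂ ≃+* ℂ) • s → σ • t = t) ∧
      ∀ y : K i₁ →+* ℂ, σ • y = y ∨ σ • y = (starRingAut : ℂ ≃+* ℂ) • y)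
    (hdeg : finrank ℚ (K i₀) = finrank ℚ (K i₁)) :
    CMAlgebra.cmFamilyRank Φ + Fintype.card I = (∑ i, cmTypeRank (Φ i)) + 1 ∨
      ∃ e : K i₀ ≃+* K i₁, ∀ u : K i₁ →+* ℂ, u ∈ (Φ i₁).1 ↔ u.comp e.toRingHom ∈ (Φ i₀).1 := by
  rcases forall_map_le_or_exists_ringEquiv_of_pairFlip_compatible (Φ := Φ) hI h01 hflip hdeg with hall | h
  · exact Or.inl (typeRank_sigmaType_add_card_eq_of_forall_map_le (G := ℂ ≃+* ℂ) (Φ := fun i => (Φ i).1)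
      (fun i => isCMTypeWith_conj (Φ i)) hall)
  · exact Or.inr h

/-- **A separating pair is additive** (no member CM-equivalent to another along a field isomorphism — e.g. simple
non-isogenous realisations): `Hg(A₀ × A₁) = Hg(A₀) × Hg(A₁)`. [cite: Gordon1999HodgeAVSurvey, 7.4–7.6]
[cite: Shimura1998, §8.3] -/
theorem cmFamilyRank_add_card_eq_of_pairFlip_compatible_of_isSeparatingFamily {i₀ i₁ : I}
    (hI : ∀ j, j = i₀ ∨ j = i₁) (h01 : i₀ ≠ i₁)
    (hflip : ∀ s : K i₀ →+* ℂ, ∃ σ : ℂ ≃+* ℂ, σ • s = (starRingAut : ℂ ≃+* ℂ) • s ∧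
      (∀ t : K i₀ →+* ℂ, t ≠ s → t ≠ (starRingAut : ℂ ≃+* ℂ) • s → σ • t = t) ∧
      ∀ y : K i₁ →+* ℂ, σ • y = y ∨ σ • y = (starRingAut : ℂ ≃+* ℂ) • y)
    (hdeg : finrank ℚ (K i₀) = finrank ℚ (K i₁)) (hsep : CMAlgebra.IsSeparatingFamily Φ) :
    CMAlgebra.cmFamilyRank Φ + Fintype.card I = (∑ i, cmTypeRank (Φ i)) + 1 := by
  rcases additive_or_exists_ringEquiv_of_pairFlip_compatible (Φ := Φ) hI h01 hflip hdeg with h | ⟨e, he⟩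
  · exact h
  · exact absurd (hsep.eq_of_forall_mem_iff_comp_mem e he) h01

/-- **A separating pair is nondegenerate iff both members are** (pair flips make `Φ_{i₀}` nondegenerate, so: iff `Φ_{i₁}`
is). [cite: Gordon1999HodgeAVSurvey, 7.5–7.6] -/
theorem isNondegenerateFamily_iff_of_pairFlip_compatible_of_isSeparatingFamily {i₀ i₁ : I}
    (hI : ∀ j, j = i₀ ∨ j = i₁) (h01 : i₀ ≠ i₁)
    (hflip : ∀ s : K i₀ →+* ℂ, ∃ σ : ℂ ≃+* ℂ, σ • s = (starRingAut : ℂ ≃+* ℂ) • s ∧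
      (∀ t : K i₀ →+* ℂ, t ≠ s → t ≠ (starRingAut : ℂ ≃+* ℂ) • s → σ • t = t) ∧
      ∀ y : K i₁ →+* ℂ, σ • y = y ∨ σ • y = (starRingAut : ℂ ≃+* ℂ) • y)
    (hdeg : finrank ℚ (K i₀) = finrank ℚ (K i₁)) (hsep : CMAlgebra.IsSeparatingFamily Φ) :
    CMAlgebra.IsNondegenerateFamily Φ ↔ IsNondegenerate (Φ i₁) := by
  rcases forall_map_le_or_exists_ringEquiv_of_pairFlip_compatible (Φ := Φ) hI h01 hflip hdeg with hall | ⟨e, he⟩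
  · obtain ⟨-, -, hnd₀⟩ := irreducible_and_finrank_eq_of_pairFlip (Φ := Φ)
      (fun s => (hflip s).imp fun σ h => ⟨h.1, h.2.1⟩)
    rw [isNondegenerateFamily_iff_forall_of_forall_map_le hall]
    exact ⟨fun h => h i₁, fun h i => by rcases hI i with rfl | rfl <;> assumption⟩
  · exact absurd (hsep.eq_of_forall_mem_iff_comp_mem e he) h01

end Dichotomy

/-! ## §3 Realisations: additive or isogenous -/

section Geometry

variable [Nonempty I] {A : I → AbelianVariety ℂ} {ι : ∀ i, 𝓞 (K i) →+* End (A i)}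
  {θ : ∀ i, K i →+* Module.End ℂ (complexBetti (A i).X 1)}

/-- **Additive or isogenous.**  For realisations `A_{i₀}`, `A_{i₁}` of the two types (`K_{i₀}` with compatible pair flips,
equal degrees): `Hg(A₀ × A₁) = Hg(A₀) × Hg(A₁)` (rank additivity) OR `A₀ ~ A₁` (CM-equivalent types have isogenous
realisations).  No simplicity is assumed, nothing on the Galois closure of `K_{i₁}`.
[cite: Shimura1998, §6.1 Cor. and §8.3] [cite: Gordon1999HodgeAVSurvey, 7.5–7.7] -/
theorem additive_or_isIsogenous_of_pairFlip_compatible {i₀ i₁ : I} (hI : ∀ j, j = i₀ ∨ j = i₁) (h01 : i₀ ≠ i₁)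
    (hflip : ∀ s : K i₀ →+* ℂ, ∃ σ : ℂ ≃+* ℂ, σ • s = (starRingAut : ℂ ≃+* ℂ) • s ∧
      (∀ t : K i₀ →+* ℂ, t ≠ s → t ≠ (starRingAut : ℂ ≃+* ℂ) • s → σ • t = t) ∧
      ∀ y : K i₁ →+* ℂ, σ • y = y ∨ σ • y = (starRingAut : ℂ ≃+* ℂ) • y)
    (hdeg : finrank ℚ (K i₀) = finrank ℚ (K i₁)) (hA : ∀ i, IsCMTypeRealisation (Φ i) (A i) (ι i) (θ i)) :
    CMAlgebra.cmFamilyRank Φ + Fintype.card I = (∑ i, cmTypeRank (Φ i)) + 1 ∨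
      AbelianVariety.IsIsogenous (A i₀) (A i₁) := by
  rcases additive_or_exists_ringEquiv_of_pairFlip_compatible (Φ := Φ) hI h01 hflip hdeg with h | ⟨e, he⟩
  · exact Or.inl h
  · exact Or.inr (isIsogenous_of_forall_mem_iff_comp e he (hA i₀) (hA i₁))

/-- **Non-isogenous realisations: the family is nondegenerate iff the partner type is** — for ANY realisations (no
simplicity) of any type of `K_{i₀}` (compatible pair flips) and any type of `K_{i₁}` of the same degree.
[cite: Gordon1999HodgeAVSurvey, 7.5–7.7] [cite: Shimura1998, §6.1 Cor.] -/
theorem isNondegenerateFamily_iff_of_pairFlip_compatible_of_not_isIsogenous {i₀ i₁ : I} (hI : ∀ j, j = i₀ ∨ j = i₁)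
    (h01 : i₀ ≠ i₁)
    (hflip : ∀ s : K i₀ →+* ℂ, ∃ σ : ℂ ≃+* ℂ, σ • s = (starRingAut : ℂ ≃+* ℂ) • s ∧
      (∀ t : K i₀ →+* ℂ, t ≠ s → t ≠ (starRingAut : ℂ ≃+* ℂ) • s → σ • t = t) ∧
      ∀ y : K i₁ →+* ℂ, σ • y = y ∨ σ • y = (starRingAut : ℂ ≃+* ℂ) • y)
    (hdeg : finrank ℚ (K i₀) = finrank ℚ (K i₁)) (hA : ∀ i, IsCMTypeRealisation (Φ i) (A i) (ι i) (θ i))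
    (hniso : ¬ AbelianVariety.IsIsogenous (A i₀) (A i₁)) :
    CMAlgebra.IsNondegenerateFamily Φ ↔ IsNondegenerate (Φ i₁) := by
  rcases forall_map_le_or_exists_ringEquiv_of_pairFlip_compatible (Φ := Φ) hI h01 hflip hdeg with hall | ⟨e, he⟩
  · obtain ⟨-, -, hnd₀⟩ := irreducible_and_finrank_eq_of_pairFlip (Φ := Φ)
      (fun s => (hflip s).imp fun σ h => ⟨h.1, h.2.1⟩)
    rw [isNondegenerateFamily_iff_forall_of_forall_map_le hall]
    exact ⟨fun h => h i₁, fun h i => by rcases hI i with rfl | rfl <;> assumption⟩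
  · exact absurd (isIsogenous_of_forall_mem_iff_comp e he (hA i₀) (hA i₁)) hniso

/-- **The Hodge conjecture on every `A₀^a × A₁^b`**, with `B• = D•` there, for NON-ISOGENOUS realisations of any type of a
CM field with compatible pair flips and of a NONDEGENERATE type of any CM field of the same degree — UNCONDITIONALLY; no
simplicity, nothing on the Galois closure of the partner. [cite: Gordon1999HodgeAVSurvey, 7.5 and 10.10] -/
theorem hodgeConjectureFor_prod_of_pairFlip_compatible_of_not_isIsogenous {i₀ i₁ : I} (hI : ∀ j, j = i₀ ∨ j = i₁)
    (h01 : i₀ ≠ i₁)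
    (hflip : ∀ s : K i₀ →+* ℂ, ∃ σ : ℂ ≃+* ℂ, σ • s = (starRingAut : ℂ ≃+* ℂ) • s ∧
      (∀ t : K i₀ →+* ℂ, t ≠ s → t ≠ (starRingAut : ℂ ≃+* ℂ) • s → σ • t = t) ∧
      ∀ y : K i₁ →+* ℂ, σ • y = y ∨ σ • y = (starRingAut : ℂ ≃+* ℂ) • y)
    (hdeg : finrank ℚ (K i₀) = finrank ℚ (K i₁)) (hA : ∀ i, IsCMTypeRealisation (Φ i) (A i) (ι i) (θ i))
    (hniso : ¬ AbelianVariety.IsIsogenous (A i₀) (A i₁)) (hnd : IsNondegenerate (Φ i₁)) {N : ℕ} (π : Fin N → I) :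
    HodgeConjectureFor (⨁ fun j : Fin N => A (π j)).dim (⨁ fun j : Fin N => A (π j)).X ∧
      ∀ m : ℕ, hodgeClassSpan (⨁ fun j : Fin N => A (π j)).dim (⨁ fun j : Fin N => A (π j)).X m =
        divisorClassesSpan (⨁ fun j : Fin N => A (π j)).X (⨁ fun j : Fin N => A (π j)).dim m :=
  have h := (isNondegenerateFamily_iff_of_pairFlip_compatible_of_not_isIsogenous hI h01 hflip hdeg hA hniso).2 hnd
  ⟨h.hodgeConjectureFor_prod hA π, fun m => h.hodgeClassSpan_prod_eq_divisorClassesSpan hA π m⟩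

/-- **Over one totally real field: additive or isogenous.**  `K_{i₀}` with pair flips, `F` totally real with
`e₀ : F → K_{i₀}`, `e₁ : F → K_{i₁}`, `[K_{i₀}:ℚ] = [K_{i₁}:ℚ] = 2[F:ℚ]`, any realisations: `Hg(A₀ × A₁) = Hg(A₀) × Hg(A₁)`
or `A₀ ~ A₁`. [cite: Shimura1998, §6.1 Cor.] [cite: Gordon1999HodgeAVSurvey, 7.5–7.7] [cite: Dodson1984, §5.1.2] -/
theorem additive_or_isIsogenous_of_pairFlip_of_ringHom_real {i₀ i₁ : I} (hI : ∀ j, j = i₀ ∨ j = i₁) (h01 : i₀ ≠ i₁)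
    (hflip : ∀ s : K i₀ →+* ℂ, ∃ σ : ℂ ≃+* ℂ, σ • s = (starRingAut : ℂ ≃+* ℂ) • s ∧
      ∀ t : K i₀ →+* ℂ, t ≠ s → t ≠ (starRingAut : ℂ ≃+* ℂ) • s → σ • t = t)
    {F : Type} [Field F] [NumberField F] [IsTotallyReal F] (e₀ : F →+* K i₀) (e₁ : F →+* K i₁)
    (hF₀ : finrank ℚ (K i₀) = 2 * finrank ℚ F) (hF₁ : finrank ℚ (K i₁) = 2 * finrank ℚ F)
    (hA : ∀ i, IsCMTypeRealisation (Φ i) (A i) (ι i) (θ i)) :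
    CMAlgebra.cmFamilyRank Φ + Fintype.card I = (∑ i, cmTypeRank (Φ i)) + 1 ∨
      AbelianVariety.IsIsogenous (A i₀) (A i₁) :=
  additive_or_isIsogenous_of_pairFlip_compatible hI h01 (pairFlip_compatible_of_ringHom_real (Φ i₀) hflip e₀ e₁ hF₁)
    (hF₀.trans hF₁.symm) hA

/-- **Over one totally real field, non-isogenous realisations**: the Hodge conjecture with `B• = D•` on every
`A₀^a × A₁^b` as soon as `Φ_{i₁}` is nondegenerate — any realisations, any `K_{i₁}` over `F`.
[cite: Gordon1999HodgeAVSurvey, 7.5 and 10.10] -/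
theorem hodgeConjectureFor_prod_of_pairFlip_of_ringHom_real_of_not_isIsogenous {i₀ i₁ : I}
    (hI : ∀ j, j = i₀ ∨ j = i₁) (h01 : i₀ ≠ i₁)
    (hflip : ∀ s : K i₀ →+* ℂ, ∃ σ : ℂ ≃+* ℂ, σ • s = (starRingAut : ℂ ≃+* ℂ) • s ∧
      ∀ t : K i₀ →+* ℂ, t ≠ s → t ≠ (starRingAut : ℂ ≃+* ℂ) • s → σ • t = t)
    {F : Type} [Field F] [NumberField F] [IsTotallyReal F] (e₀ : F →+* K i₀) (e₁ : F →+* K i₁)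
    (hF₀ : finrank ℚ (K i₀) = 2 * finrank ℚ F) (hF₁ : finrank ℚ (K i₁) = 2 * finrank ℚ F)
    (hA : ∀ i, IsCMTypeRealisation (Φ i) (A i) (ι i) (θ i)) (hniso : ¬ AbelianVariety.IsIsogenous (A i₀) (A i₁))
    (hnd : IsNondegenerate (Φ i₁)) {N : ℕ} (π : Fin N → I) :
    HodgeConjectureFor (⨁ fun j : Fin N => A (π j)).dim (⨁ fun j : Fin N => A (π j)).X ∧
      ∀ m : ℕ, hodgeClassSpan (⨁ fun j : Fin N => A (π j)).dim (⨁ fun j : Fin N => A (π j)).X m =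
        divisorClassesSpan (⨁ fun j : Fin N => A (π j)).X (⨁ fun j : Fin N => A (π j)).dim m :=
  hodgeConjectureFor_prod_of_pairFlip_compatible_of_not_isIsogenous hI h01
    (pairFlip_compatible_of_ringHom_real (Φ i₀) hflip e₀ e₁ hF₁) (hF₀.trans hF₁.symm) hA hniso hnd π

end Geometry

end Summit.HodgeConjecture.CorCM

end
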